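import Summits.CriticalPhenomena.CardyFormulaZ2.Theorems.CardyIKTransportIKLinearTransportWallDomination
import Summits.CriticalPhenomena.CardyFormulaZ2.Theorems.CardyIKTransportIKLinearTransportWallDominationHonThinRingMargin

/-!
# `CardyIKTransport.IKLinearTransport` (stmt-CriticalPhenomena-5076), line `pinned-diagram-exchange`, lead c8 —
# WALL DOMINATION, application: thin rings through the wall with FREE MARGINS, for every column pattern

Support file (`--supports stmt-CriticalPhenomena-5076`, registered sub-goal `thinRingChain_margin_all`).  Composition of the landed
`twoWallDomination` (`…WallDomination.lean`) with the landed site-`𝕋` input `honThinRingChain_margin`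
(`…WallDominationHonThinRingMargin.lean`).  GEOMETRY (the one the planar transfer of the lead's wave 3 consumes): slab of `s + s`
face columns (wall = cell column `s`), cylinder of circumference `L = 2M + 7s + 1` read as: bottom margin `[0, M)`, lower window
`B = [M, M+s)`, core `[M+s, M+2s)` (the protected wall segment), upper window `A = [M+2s, M+3s)`, top margin `[M+3s, 2M+3s)`, off-band
`[2M+3s, L)` (`4s + 1` rows, what the band comparison `CylPlane.cylProb_bandQ_le` / `qProb_le_cylProb_band` needs); the constant does
not depend on the margin height `M`.
-/

noncomputable section

namespace Summit.CriticalPhenomena.CardyFormulaZ2.Theorems.IKLinearTransport.PinnedDiagramExchange.WallDomination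

open Summit.CriticalPhenomena.CardyFormulaZ2.Cruxes.IKMixedBoxCrossing.DefectClosureExploration

/-- **THIN RINGS THROUGH THE WALL WITH FREE MARGINS, FOR EVERY COLUMN PATTERN** (registered sub-goal `thinRingChain_margin_all`):
with the site-`𝕋` constant `c > 0` of `honThinRingChain_margin`, for every `s ≥ 1`, every margin height `M`, `L = 2M + 7s + 1` and every
face-type pattern `τ` on the slab of `s + s` face columns, the chained thin-ring event with windows `A = [M+2s, M+3s)`, `B = [M, M+s)` has
`cylProb`-probability `≥ c`. -/
theorem thinRingChain_margin_all : ∃ c : ℝ, 0 < c ∧ ∀ (s M : ℕ), 1 ≤ s → ∀ (L : ℕ) [NeZero L], L = 2 * M + 7 * s + 1 →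
    ∀ τ : Fin (s + s) → Bool, c ≤ cylProb (s + s) L τ
      (thinRingChain s s {r : ZMod L | M + 2 * s ≤ r.val ∧ r.val < M + 3 * s} {r : ZMod L | M ≤ r.val ∧ r.val < M + s}) := by
  obtain ⟨c, hc, h⟩ := honThinRingChain_margin
  refine ⟨c, hc, fun s M hs L _ hL τ => (h s M hs L hL).trans ?_⟩
  exact twoWallDomination s s L (by omega) τ _ (twoWallMonotone_thinRingChain s s _ _)

end Summit.CriticalPhenomena.CardyFormulaZ2.Theorems.IKLinearTransport.PinnedDiagramExchange.WallDomination

end
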